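import Mathlib
import Summits.Ventures.PercRepro2.Defs
import Summits.Ventures.PercRepro2.Graph
import Summits.Ventures.PercRepro2.MM0Sector
import Summits.Ventures.PercRepro2.MM0Pinned
import Summits.Ventures.PercRepro2.MM0LocalInjection
import Summits.Ventures.PercRepro2.MM0SExchange

/-!
# The pinned (MM0⁻) coefficient along the s-exchange
(blind cell PercRepro2, night-1 g3; `proofs/NIGHT1-INJ.md` §2)

With `g(x, z) = 1_gate(x) (1_Zev(x) − 1_Z₀(z))` (`tSide`) the three-copy kernel of (MM0⁻) is
`K(x,y,z) = 1_R(y) 1_R(z) (1_Y(x) − 1_Y(y)) g(x, z)` (`tripleKernel_eq_tSide`), and along the s-exchange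
`σ` of `MM0SExchange.lean` (which exchanges the s-clusters of `x` and `y` and fixes `z`)

  `K(x,y,z) + K(σ(x,y,z)) = 1_R(x) 1_R(y) 1_R(z) (1_Y(x) − 1_Y(y)) (g(x,z) − g(x',z))`

(`tripleKernel_add_sExchange`).  Since `σ` is an involution of every fibre (`sExchange_mem_fibre`),

  **`2 c(pat) = ∑_{fibre(pat)} 1_R(x) 1_R(y) 1_R(z) (1_Y(x) − 1_Y(y)) (g(x,z) − g(x',z))`**

(`two_mul_patternCoeff3`): the pinned statement `PinnedMM0` of row 2′MM0 says exactly that, summed over a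
fibre, the t-side functional `g` of the `x`-copy does not grow on average when the s-cluster of `x` is
replaced by the s-cluster of `y` (the sign `1_Y(x) − 1_Y(y)` records which of the two clusters carries `b`).
When `C_y(s)` avoids `K⁺_x` and no `y`-open edge joins `C_x(s) ∖ C_y(s)` to `K⁺_x`, the t-side of `x` is
untouched and the summand vanishes (paper, NIGHT1-INJ.md §2; census 0 exceptions / 240); the content of
`PinnedMM0` sits in the overlapping triples.  Standard axioms, Mathlib + cell prefix only.
-/

namespace Summit.Ventures.PercRepro2
namespace MM0Pinned

open MM0Sector

variable {V : Type*} {E : Type*} [Fintype E] [DecidableEq E] [Fintype V] [DecidableEq V]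

/-! ## The kernel along the s-exchange -/

section KernelExchange

variable {R : Type*} [CommRing R]
variable (ends : E → Sym2 V) (s t b u w v : V)

open Classical in
/-- The t-side functional of the `x`-copy against the `z`-reference:
`g(x, z) = 1_gate(x) (1_Zev(x) − 1_Z₀(z))`. -/
noncomputable def tSide (x z : Config E) : R :=
  (if x ∈ gate ends s t u w then 1 else 0) *
    ((if x ∈ Zev ends t u w v then 1 else 0) - (if z ∈ connEvent ends t v then 1 else 0))

omit [Fintype E] [DecidableEq E] [Fintype V] [DecidableEq V] in
open Classical in
/-- The kernel as `1_R(y) 1_R(z) (1_Y(x) − 1_Y(y)) · g(x, z)`. -/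
lemma tripleKernel_eq_tSide (x y z : Config E) :
    tripleKernel (R := R) ends s t b u w v x y z =
      (if y ∈ (connEvent ends s t)ᶜ then 1 else 0) * (if z ∈ (connEvent ends s t)ᶜ then 1 else 0) *
        ((if x ∈ connEvent ends s b then 1 else 0) - (if y ∈ connEvent ends s b then 1 else 0)) *
        tSide (R := R) ends s t u w v x z := by
  rw [tripleKernel_eq_prod]; unfold tSide; ring

omit [Fintype E] [DecidableEq E] [Fintype V] [DecidableEq V] in
open Classical in
/-- `g(x, z)` vanishes unless `x ∈ R`. -/
lemma tSide_eq_zero_of_notMem {x z : Config E} (hx : x ∉ (connEvent ends s t)ᶜ) :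
    tSide (R := R) ends s t u w v x z = 0 := by
  have hg : x ∉ gate ends s t u w := fun h => hx h.1
  unfold tSide; rw [if_neg hg, zero_mul]

omit [Fintype E] [DecidableEq E] [Fintype V] [DecidableEq V] in
open Classical in
/-- **The kernel along the s-exchange**:
`K(x,y,z) + K(σ(x,y,z)) = 1_R(x) 1_R(y) 1_R(z) (1_Y(x) − 1_Y(y)) (g(x,z) − g(x',z))`. -/
theorem tripleKernel_add_sExchange (xyz : Config E × Config E × Config E) :
    tripleKernel (R := R) ends s t b u w v xyz.1 xyz.2.1 xyz.2.2 +
      tripleKernel (R := R) ends s t b u w v (sExchange ends s xyz).1 (sExchange ends s xyz).2.1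
        (sExchange ends s xyz).2.2 =
      (if xyz.1 ∈ (connEvent ends s t)ᶜ then 1 else 0) *
        (if xyz.2.1 ∈ (connEvent ends s t)ᶜ then 1 else 0) *
        (if xyz.2.2 ∈ (connEvent ends s t)ᶜ then 1 else 0) *
        ((if xyz.1 ∈ connEvent ends s b then 1 else 0) -
          (if xyz.2.1 ∈ connEvent ends s b then 1 else 0)) *
        (tSide (R := R) ends s t u w v xyz.1 xyz.2.2 -
          tSide (R := R) ends s t u w v (sExchange ends s xyz).1 xyz.2.2) := by
  rw [tripleKernel_eq_tSide, tripleKernel_eq_tSide, sExchange_third]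
  have h1 : ((sExchange ends s xyz).2.1 ∈ (connEvent ends s t)ᶜ) ↔
      (xyz.1 ∈ (connEvent ends s t)ᶜ) := by
    simp only [Set.mem_compl_iff, mem_connEvent, conn_sExchange_snd_iff]
  have h2 : ((sExchange ends s xyz).1 ∈ connEvent ends s b) ↔ (xyz.2.1 ∈ connEvent ends s b) := by
    simp only [mem_connEvent, conn_sExchange_fst_iff]
  have h3 : ((sExchange ends s xyz).2.1 ∈ connEvent ends s b) ↔ (xyz.1 ∈ connEvent ends s b) := by
    simp only [mem_connEvent, conn_sExchange_snd_iff]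
  have h4 : ((sExchange ends s xyz).1 ∈ (connEvent ends s t)ᶜ) ↔
      (xyz.2.1 ∈ (connEvent ends s t)ᶜ) := by
    simp only [Set.mem_compl_iff, mem_connEvent, conn_sExchange_fst_iff]
  simp only [h1, h2, h3]
  by_cases hxR : xyz.1 ∈ (connEvent ends s t)ᶜ
  · by_cases hyR : xyz.2.1 ∈ (connEvent ends s t)ᶜ
    · simp only [hxR, hyR, if_true]; ring
    · have h0 := tSide_eq_zero_of_notMem (R := R) ends s t u w v (z := xyz.2.2) (h4.not.2 hyR)
      simp only [hxR, hyR, if_true, if_false, h0]; ring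
  · have h0 := tSide_eq_zero_of_notMem (R := R) ends s t u w v (z := xyz.2.2) hxR
    simp only [hxR, if_false, h0]; ring

omit [Fintype E] [DecidableEq E] [Fintype V] [DecidableEq V] in
/-- The s-exchange preserves the order statistics (`stats`), hence maps every fibre to itself. -/
theorem stats_sExchange (xyz : Config E × Config E × Config E) :
    stats (sExchange ends s xyz) = stats xyz := by
  obtain ⟨h1, h2, h3⟩ := orderStats_sExchange (ends := ends) (s := s) xyz
  simp only [stats, h1, h2, h3]

omit [Fintype V] [DecidableEq V] in
/-- The s-exchange maps every fibre to itself. -/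
theorem sExchange_mem_fibre {pat xyz : Config E × Config E × Config E} (h : xyz ∈ fibre pat) :
    sExchange ends s xyz ∈ fibre pat := by
  simp only [fibre, Finset.mem_filter, Finset.mem_univ, true_and] at h ⊢
  rw [stats_sExchange, h]

omit [Fintype V] [DecidableEq V] in
open Classical in
/-- **Twice the pattern coefficient along the s-exchange**:
`2 c(pat) = ∑_{fibre} 1_R(x) 1_R(y) 1_R(z) (1_Y(x) − 1_Y(y)) (g(x,z) − g(x',z))`. -/
theorem two_mul_patternCoeff3 (pat : Config E × Config E × Config E) :
    2 * patternCoeff3 (R := R) ends s t b u w v pat =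
      ∑ xyz ∈ fibre pat,
        (if xyz.1 ∈ (connEvent ends s t)ᶜ then 1 else 0) *
          (if xyz.2.1 ∈ (connEvent ends s t)ᶜ then 1 else 0) *
          (if xyz.2.2 ∈ (connEvent ends s t)ᶜ then 1 else 0) *
          ((if xyz.1 ∈ connEvent ends s b then 1 else 0) -
            (if xyz.2.1 ∈ connEvent ends s b then 1 else 0)) *
          (tSide (R := R) ends s t u w v xyz.1 xyz.2.2 -
            tSide (R := R) ends s t u w v (sExchange ends s xyz).1 xyz.2.2) := by
  have hsum : patternCoeff3 (R := R) ends s t b u w v pat =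
      ∑ xyz ∈ fibre pat, tripleKernel (R := R) ends s t b u w v xyz.1 xyz.2.1 xyz.2.2 := by
    unfold patternCoeff3 fibre
    rw [Finset.sum_filter]
    rfl
  have hre : ∑ xyz ∈ fibre pat, tripleKernel (R := R) ends s t b u w v xyz.1 xyz.2.1 xyz.2.2 =
      ∑ xyz ∈ fibre pat, tripleKernel (R := R) ends s t b u w v (sExchange ends s xyz).1
        (sExchange ends s xyz).2.1 (sExchange ends s xyz).2.2 := by
    refine Finset.sum_nbij' (sExchange ends s) (sExchange ends s)
      (fun a ha => sExchange_mem_fibre ends s ha) (fun a ha => sExchange_mem_fibre ends s ha)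
      (fun a _ => sExchange_sExchange a) (fun a _ => sExchange_sExchange a) (fun a _ => ?_)
    rw [sExchange_sExchange]
  have h2 : 2 * patternCoeff3 (R := R) ends s t b u w v pat =
      (∑ xyz ∈ fibre pat, tripleKernel (R := R) ends s t b u w v xyz.1 xyz.2.1 xyz.2.2) +
        ∑ xyz ∈ fibre pat, tripleKernel (R := R) ends s t b u w v (sExchange ends s xyz).1
          (sExchange ends s xyz).2.1 (sExchange ends s xyz).2.2 := by
    rw [two_mul, ← hre, hsum]
  rw [h2, ← Finset.sum_add_distrib]
  refine Finset.sum_congr rfl fun xyz _ => ?_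
  rw [tripleKernel_add_sExchange]

end KernelExchange

/-! ## The sharper hypothesis: injections by single two-copy swaps in the s- or t-region -/

section SwapInjection

variable {R : Type*} [CommRing R]
variable (ends : E → Sym2 V) (s t b u w v : V)

open Classical in
/-- Swap the `x`- and `y`-status of the edges of `A`; `z` untouched. -/
noncomputable def swapXY (A : Set E) (xyz : Config E × Config E × Config E) :
    Config E × Config E × Config E :=
  (fun e => if e ∈ A then xyz.2.1 e else xyz.1 e, fun e => if e ∈ A then xyz.1 e else xyz.2.1 e,
    xyz.2.2)

open Classical in
/-- Swap the `x`- and `z`-status of the edges of `A`; `y` untouched. -/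
noncomputable def swapXZ (A : Set E) (xyz : Config E × Config E × Config E) :
    Config E × Config E × Config E :=
  (fun e => if e ∈ A then xyz.2.2 e else xyz.1 e, xyz.2.1,
    fun e => if e ∈ A then xyz.1 e else xyz.2.2 e)

/-- The s-region of a triple: the edges touching `C_x(s) ∪ C_y(s)`. -/
def sRegion (xyz : Config E × Config E × Config E) : Set E :=
  touches ends (cluster ends xyz.1 s ∪ cluster ends xyz.2.1 s)

/-- The t-region of a triple: the edges touching `K⁺_x ∪ C_z(t)`. -/
def tRegion (xyz : Config E × Config E × Config E) : Set E :=
  touches ends (kplus ends t u w xyz.1 ∪ cluster ends xyz.2.2 t)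

variable [LinearOrder R]

/-- **`LocalSwapInjection`**: on every fibre an injection from the `+1`-triples to the `−1`-triples in
which every move is ONE two-copy swap — `x ↔ y` on a subset of the s-region, or `x ↔ z` on a subset
of the t-region (census-true on the `n = 6` atlas, night-1 g3). -/
def LocalSwapInjection : Prop :=
  ∀ pat : Config E × Config E × Config E,
    ∃ f : Config E × Config E × Config E → Config E × Config E × Config E,
      Set.MapsTo f (posFibre (R := R) ends s t b u w v pat) (negFibre (R := R) ends s t b u w v pat) ∧
      Set.InjOn f (posFibre (R := R) ends s t b u w v pat) ∧
      ∀ xyz ∈ posFibre (R := R) ends s t b u w v pat,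
        (∃ A ⊆ sRegion ends s xyz, f xyz = swapXY A xyz) ∨
        (∃ A ⊆ tRegion ends t u w xyz, f xyz = swapXZ A xyz)

omit [Fintype E] [DecidableEq E] [Fintype V] [DecidableEq V] in
/-- The s-region lies in the edges touching the four-cluster locality set. -/
lemma sRegion_subset (xyz : Config E × Config E × Config E) :
    sRegion ends s xyz ⊆ touches ends (localSet ends s t u w xyz) := by
  rintro e ⟨a, ha, c, hac⟩
  refine ⟨a, ?_, c, hac⟩
  rcases ha with ha | ha
  · exact Or.inl (Or.inl (Or.inl ha))
  · exact Or.inl (Or.inr ha)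

omit [Fintype E] [DecidableEq E] [Fintype V] [DecidableEq V] in
/-- The t-region lies in the edges touching the four-cluster locality set. -/
lemma tRegion_subset (xyz : Config E × Config E × Config E) :
    tRegion ends t u w xyz ⊆ touches ends (localSet ends s t u w xyz) := by
  rintro e ⟨a, ha, c, hac⟩
  refine ⟨a, ?_, c, hac⟩
  rcases ha with ha | ha
  · exact Or.inl (Or.inl (Or.inr ha))
  · exact Or.inr ha

omit [Fintype E] [DecidableEq E] [Fintype V] [DecidableEq V] in
open Classical in
/-- A swap on a subset of the s-region is a local move. -/
lemma localMove_swapXY {A : Set E} (xyz : Config E × Config E × Config E)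
    (hA : A ⊆ sRegion ends s xyz) : LocalMove ends s t u w xyz (swapXY A xyz) := by
  intro e he
  have heA : e ∉ A := fun h => he (sRegion_subset ends s t u w xyz (hA h))
  simp only [swapXY, if_neg heA, and_self]

omit [Fintype E] [DecidableEq E] [Fintype V] [DecidableEq V] in
open Classical in
/-- A swap on a subset of the t-region is a local move. -/
lemma localMove_swapXZ {A : Set E} (xyz : Config E × Config E × Config E)
    (hA : A ⊆ tRegion ends t u w xyz) : LocalMove ends s t u w xyz (swapXZ A xyz) := by
  intro e he
  have heA : e ∉ A := fun h => he (tRegion_subset ends s t u w xyz (hA h))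
  simp only [swapXZ, if_neg heA, and_self]

omit [Fintype V] [DecidableEq V] [LinearOrder R] in
/-- `LocalSwapInjection → LocalInjection3`. -/
theorem localInjection3_of_localSwapInjection (h : LocalSwapInjection (R := R) ends s t b u w v) :
    LocalInjection3 (R := R) ends s t b u w v := by
  intro pat
  obtain ⟨f, hmaps, hinj, hloc⟩ := h pat
  refine ⟨f, hmaps, hinj, fun xyz hx => ?_⟩
  rcases hloc xyz hx with ⟨A, hA, hf⟩ | ⟨A, hA, hf⟩
  · rw [hf]; exact localMove_swapXY ends s t u w xyz hA
  · rw [hf]; exact localMove_swapXZ ends s t u w xyz hA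

variable [IsStrictOrderedRing R]

omit [Fintype V] [DecidableEq V] in
/-- **`LocalSwapInjection → PinnedMM0`**. -/
theorem pinnedMM0_of_localSwapInjection (h : LocalSwapInjection (R := R) ends s t b u w v) :
    PinnedMM0 (R := R) ends s t b u w v :=
  pinnedMM0_of_localInjection3 ends s t b u w v
    (localInjection3_of_localSwapInjection ends s t b u w v h)

end SwapInjection

end MM0Pinned
end Summit.Ventures.PercRepro2
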